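import Summits.QuantumFields.BalabanUV.Beta.D1BFx.PackedAveragingWords
import Summits.QuantumFields.BalabanUV.Beta.D1BFx.CoframeTableMassScales
import Summits.QuantumFields.BalabanUV.Beta.D1BFx.RestKernelGhostDelta
import Summits.QuantumFields.BalabanUV.Beta.D1BFx.GhostDeficitFormula

/-!
# `BalabanUV.Beta.D1BFx.GhostQWordsScales` — road «BF-x» for binder row D1, slot (K), (J3)'s (C3) rows: **«THE FOUR `Q′`-WORDS OF `BR n` HAVE
# m-UNIFORMLY BOUNDED, ABSOLUTELY SUMMABLE (1.22) SECOND MOMENTS ON THE SCALES `n = L^k`» — THE OWNER's PART 16 BINDERS `hMRB ∕ hCB` AS THEOREMS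
# (`exists_C3_rows`), by the DIRECT count of W-2 l.45546: `|BR (L^k) c e z| ≤ KB·e^{−σB|z|₁}` with ONE `KB`, ONE `σB > 0` for every `k ≥ 1` (`exists_abs_BR_road_le`)**

HONEST DEPENDENCY (cell records, verbatim): «continuum YM on T⁴ ⇐ BetaPertH ∧ nine spine estimates (0/9 proved); BetaPertH ⇐ (D1) ∧ (D4) ∧
CAP+tail; G-an2-4 gates asym, D1 and NE2/3/4.»  HONEST FRAMING (cell contract, verbatim): «discharging `BetaPertH` makes Bałaban's UV stability
UNCONDITIONAL — a real constructive-QFT result; it is NOT the continuum limit and NOT the Clay problem.»  THIS MODULE DISCHARGES NOTHING of the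
wall: [folklore] composition BY NAME of tree letters — ε1 `PackedAveragingVertex` ∕ ε1b `PackedAveragingTable` ∕ ε2 `PackedAveragingWords` (this lineage, g55), γ3 `CompositeLegMasses.exists_leg_masses`
(the ghost leg's n-free θ-weighted masses on `n = L^k`, from lit-balaban's `B3GkZeroLatticePointwise` via β1∕β2), d1-leaf-04 g18's sharp sup `RestKernelGhostDelta.bdd_Ggh_sharp`,
«G0-COL-ENV» `PackedColumnEnvelope.abs_colH_G₀_road_le` (g53), δ4b's `CoframeMassUniform.Zl_road_le`, leaf-03 g25's `CoframeTableMassScales.box_of_succ`, the OWNER's packing scalars `GhostDeficitFormula.sum_wsum_smul`,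
and the Literature's `B12Sec2to5.secondMoment_abs_le_of_decay510` ∕ `DecimatedMomentSummable.absMoment₂_of_decay510`.  UNCONDITIONAL in the road's objects
(`2 ≤ L`, `0 < a`, in-block roots).  No definition, no `def … : Prop`, nothing cited, 0 sorry.  It proves the LETTERS of two displayed binders of ONE junction of
ONE slot; nothing of Bałaban's is asserted; the GAP ROW `hGap` (F-g20-1) and (J1)(J2) are untouched; 0 root-level binders of row D1 discharged
(hW ∕ hR-sockets ∕ hSX-socket ∕ D1Tel ∕ D1Rep = 0); (K) NOT closed; NOT D1, NOT `BetaPertH`, NOT continuum, NOT Clay.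

ABSOLUTE RULE (cell charter, verbatim): «No internally-minted statement may enter as a cited fact. Every hypothesis is either kernel-proved in
this package or a verbatim quotation of a PUBLISHED theorem with page reference. The manuscript(s) under audit are NOT citable for their own
disputed steps — they are the thing under adjudication; programme-internal (2001/route/tribunal) claims are never citable.»

WHY (OWNER d1-p2 g20 INTENT-4 l.44897 ∕ PART 16 `RoadEndBFxRoadScalesJ3S` v1.1 rows `hMRB hCB`, first refusal to this lineage; W-2 l.45546).  With `GhostDeficitFormula.J3_closed_form`
the (J3) rest is `(4N²n⁸ − 2)·PghQ(unit ray) + 2·BR n`; the END needs of `BR` absolutely summable, m-uniformly bounded (1.22) second moments.  `BR n c e z` =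
`½·tadpole (Ggh n a) 𝒲 − ½·(bubble Ggh 𝒱_D[c0] 𝒱_Q[ez] + bubble Ggh 𝒱_Q[c0] 𝒱_D[ez] + bubble Ggh 𝒱_Q[c0] 𝒱_Q[ez])` at the road's dressed weights `W = colH G₀ n`
(`G₀ = coDressKBmAt (toSite r) n (KInvStep 3 n 0)`), stencil root `ctrHalf n`, unit ray: `𝒱_D = n²•gW (W μ y)`, `𝒱_Q = a•qV (ctrHalf n) n (W μ y)`, `𝒲 = (a n⁴)·(qV ⊙ qV)` (§1).
ε2's four word bounds at `A = Ggh n a` (§2, any scale, any envelope) and the road's letters on the scales (§3: `sup|Ggh| ≤ (cG0 + cSplit)∕n²`, masses `g` at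
`θ = θ₁∕n`, `θ₁ = min θ₀ (κ∕32)`, weights `n⁻⁴·C₁·e^{−(κ∕16n)|u − n•y|₁}`, `Zl ≤ n⁴·(1 + 64∕κ)⁴`) give every word `≤ (n-free)·n^{−j}·e^{−θ₁|z|₁}`, `j ≥ 3` (cross `n⁻³`,
pure `n⁻⁴`, tadpole `n⁻⁴`); §4 reads the (1.22) rows.  HONEST CAVEAT: these are the rows AS TYPED (unweighted `BR`); under the OWNER's ρ-g20-2 ∕ F-g20-1 tower weight
`Λ = 2N²n⁸` NO lane's unweighted letters are n-uniform — that units question is (J1)'s ∕ the END's, not (C3)'s.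

CONTENT (all [folklore]).
* §1 `sum_wsum_smul_ghCur` (`Σ_κ wsum (w κ) (u ↦ c•ghCur κ u) = c•gW w`), `sum_wsum_smul_qAntiAt` (`… = c•qV ρ n w`).
* §2 **`abs_BR_le`** (ANY scale `n`, root `ρ`, weight family `W` with envelope `C·e^{−δ|u − n•y|₁}`, leg sup `β`, θ-masses `g`, `0 ≤ θ < δ`):
  `|BR| ≤ ½·β·(T + B₁ + B₂ + B₃)·e^{−θ|n•0 − n•z|₁}` with the four ε2 constants spelled out.
* §3 `eight_mul_rate`, `word_consts_le` (the n-free majorants, pure algebra at `q ≥ 1`), **`exists_abs_BR_road_le`**: `∃ KB σB, 0 < σB ∧ 0 ≤ KB ∧ ∀ k ≥ 1, ∀ n = L^k, ∀ r ∈ box 4 n,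
  ∀ c e z, |BR n c e z| ≤ KB·e^{−σB|z|₁}`.
* §4 **`exists_C3_rows`**: for a per-scale root family `r (m+1) ∈ box 4 (m+1)`: `∃ CB, ∀ m ≥ 1, (∀ c e, AbsMoment₂ (z ↦ BR (L^m) c e z)) ∧ ∀ μ ν,
  |secondMoment (c e z ↦ BR (L^m) c e z) μ ν| ≤ CB` — PART 16's `hMRB` ∕ `hCB` character for character (`Lc ↦ L`).
Unit `b2b-balaban-gan24-formalise-leaf-05` (gen 55), G-an2-4 swarm leaf prover 05, road «BF-x» supplier; INTENT «(C3) DIRECT» ε3 (journal).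
-/

noncomputable section

namespace Summit.QuantumFields.BalabanUV.Beta.D1BFx.GhostQWordsScales

open Finset
open scoped BigOperators
open Literature.MathematicalPhysics.QuantumFieldTheory.Balaban1983to89
open Literature.MathematicalPhysics.QuantumFieldTheory.Balaban1983to89.Beta
open B12Sec2to5 (l1 l1_nonneg Decay510)
open B5Hk163Strip (kappa163 kappa163_pos)
open B5Hk163Decay (MG163)
open B4TorusKernel (periodConst)
open ExpKernelCalculus (Site MKer comp tr bubble tadpole Zl Zl_pos l1_sub_symm l1_natSmul)
open AffineAveraging (box toSite)
open OneStepResolventKernel (wsum)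
open OneStepKernelFamily (KInvStep colH)
open DecimatedMomentSummable (AbsMoment₂ absMoment₂_of_decay510)
open Summit.QuantumFields.BalabanUV.Beta.AxialDressingRooted (coDressKBmAt)
open Summit.QuantumFields.BalabanUV.Beta.D1BFx.GhostLeg (Ggh)
open Summit.QuantumFields.BalabanUV.Beta.D1BFx.GhostStencil (ghCur)
open Summit.QuantumFields.BalabanUV.Beta.D1BFx.GhostStencilRooted (qAntiAt)
open Summit.QuantumFields.BalabanUV.Beta.D1BFx.GhostStencilRootedReflection (ctrHalf)
open Summit.QuantumFields.BalabanUV.Beta.D1BFx.GhostAveragingSquare (qSqAt)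
open Summit.QuantumFields.BalabanUV.Beta.D1BFx.PackedCoframeSiteWords (gW)
open Summit.QuantumFields.BalabanUV.Beta.D1BFx.PointColumnSplit (cG0 cG0_nonneg cSplit cSplit_nonneg)
open Summit.QuantumFields.BalabanUV.Beta.D1BFx.PackedColumnEnvelope (abs_colH_G₀_road_le colH_G₀_road_weight_nonneg)
open Summit.QuantumFields.BalabanUV.Beta.D1BFx.RestKernelGhostUnit (abs_secondMoment_le momentSum_nonneg)
open Summit.QuantumFields.BalabanUV.Beta.D1BFx.RestKernelGhostDelta (bdd_Ggh_sharp)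
open Summit.QuantumFields.BalabanUV.Beta.D1BFx.GhostDeficitFormula (sum_wsum_smul)
open Summit.QuantumFields.BalabanUV.Beta.D1BFx.CompositeLegMasses (exists_leg_masses)
open Summit.QuantumFields.BalabanUV.Beta.D1BFx.CoframeMassUniform (Zl_road_le)
open Summit.QuantumFields.BalabanUV.Beta.D1BFx.CoframeTableMassScales (box_of_succ)
open Summit.QuantumFields.BalabanUV.Beta.D1BFx.KernelMassCalculus
open Summit.QuantumFields.BalabanUV.Beta.D1BFx.KernelMassTotal
open Summit.QuantumFields.BalabanUV.Beta.D1BFx.PackedAveragingVertex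
open Summit.QuantumFields.BalabanUV.Beta.D1BFx.PackedAveragingTable
open Summit.QuantumFields.BalabanUV.Beta.D1BFx.PackedAveragingWords

/-! ## §1 The road's packed jets are scalar multiples of `gW` and `qV` -/

section Bridges

variable (ρ : Site 4) (n : ℕ) (w : Fin 4 → Site 4 → ℝ) (c : ℝ)

/-- [folklore] The packed `D*D` current with a scalar: `Σ_κ wsum (w κ) (u ↦ c•ghCur κ u) = c•gW w` (the OWNER's `sum_wsum_smul`; `gW` by `rfl`). -/
theorem sum_wsum_smul_ghCur : (∑ κ : Fin 4, wsum (w κ) (fun u => c • ghCur κ u)) = c • gW w := by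
  rw [sum_wsum_smul]; rfl

/-- [folklore] The packed averaging current with a scalar: `Σ_κ wsum (w κ) (u ↦ c•qAntiAt ρ n κ u) = c•qV ρ n w` (ε1's `qV` by `rfl`). -/
theorem sum_wsum_smul_qAntiAt : (∑ κ : Fin 4, wsum (w κ) (fun u => c • qAntiAt ρ n κ u)) = c • qV ρ n w := by
  rw [sum_wsum_smul]; rfl

end Bridges

/-! ## §2 The bracket of the four `Q′`-words at one scale, any localised weight family -/

section OneScale

variable (ρ : Site 4) (n : ℕ) [NeZero n] {a : ℝ} {W : Fin 4 → Site 4 → Fin 4 → Site 4 → ℝ} {C δ θ g β : ℝ}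

/-- [folklore] **THE FOUR `Q′`-WORDS AT ONE SCALE** (root `ρ`, weights `W μ y κ u` with envelope `C·e^{−δ|u − n•y|₁}`, leg `Ggh n a` with `|Ggh| ≤ β` and θ-weighted
row∕column mass `g`, `0 ≤ θ < δ`): the bracket `½·tadpole − ½·(three bubbles)` at the bonds `(c,0)`, `(e,z)` is
`≤ ½·β·(T + B₁ + B₂ + B₃)·e^{−θ|n•0 − n•z|₁}` with ε2's four constants (§3 reads them at the road's letters). -/
theorem abs_BR_le (hW : ∀ μ y κ u, |W μ y κ u| ≤ C * Real.exp (-δ * l1 (u - (n : ℤ) • y))) (hθ : 0 ≤ θ) (hθδ : θ < δ)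
    (hAβ : ∀ x y : Site 4, |Ggh n a x y () ()| ≤ β) (hA : RowMass (Ggh n a) θ g ∧ ColMass (Ggh n a) θ g) (c e : Fin 4) (z : Site 4) :
    |(1 / 2) * tadpole (Ggh n a) (∑ κ : Fin 4, ∑ l : Fin 4, wsum (W c 0 κ)
            (fun u => wsum (W e z l) (fun v' => (-((-1) * a * (n : ℝ) ^ 4)) • qSqAt ρ n κ u l v')))
        - (1 / 2) * (bubble (Ggh n a) (∑ κ : Fin 4, wsum (W c 0 κ) (fun u => ((n : ℝ) ^ 2) • ghCur κ u))
              (∑ κ : Fin 4, wsum (W e z κ) (fun u => a • qAntiAt ρ n κ u))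
            + bubble (Ggh n a) (∑ κ : Fin 4, wsum (W c 0 κ) (fun u => a • qAntiAt ρ n κ u))
              (∑ κ : Fin 4, wsum (W e z κ) (fun u => ((n : ℝ) ^ 2) • ghCur κ u))
            + bubble (Ggh n a) (∑ κ : Fin 4, wsum (W c 0 κ) (fun u => a • qAntiAt ρ n κ u))
              (∑ κ : Fin 4, wsum (W e z κ) (fun u => a • qAntiAt ρ n κ u)))|
      ≤ (1 / 2) * (β * ((|(-((-1) * a * (n : ℝ) ^ 4))| * (8 * n * ((n : ℝ) ^ 4)⁻¹ * C * Real.exp (8 * n * δ)) * (8 * n * C * Real.exp (8 * n * δ))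
              * Zl 4 (δ - θ))
            + (|(n : ℝ) ^ 2| * (8 * C * Real.exp δ)) * (|a| * (8 * n * C * Real.exp (8 * n * δ))) * g * Zl 4 (δ - θ)
            + (|a| * (8 * n * C * Real.exp (8 * n * δ))) * (|(n : ℝ) ^ 2| * (8 * C * Real.exp δ)) * g * Zl 4 (δ - θ)
            + (|a| * (8 * n * C * Real.exp (8 * n * δ))) * (|a| * (8 * n * C * Real.exp (8 * n * δ))) * g * Zl 4 (δ - θ)))
          * Real.exp (-θ * l1 ((n : ℤ) • (0 : Site 4) - (n : ℤ) • z)) := by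
  simp only [sum_sum_wsum_qSqAt, sum_wsum_smul_ghCur, sum_wsum_smul_qAntiAt]
  have hw : ∀ κ u, |W c 0 κ u| ≤ C * Real.exp (-δ * l1 (u - (n : ℤ) • (0 : Site 4))) := fun κ u => hW c 0 κ u
  have hw' : ∀ κ u, |W e z κ u| ≤ C * Real.exp (-δ * l1 (u - (n : ℤ) • z)) := fun κ u => hW e z κ u
  have hT := abs_tadpole_QQ_le ρ n hAβ hθ hθδ hw hw' (-((-1) * a * (n : ℝ) ^ 4))
  have h1 := abs_bubble_DQ_le ρ n hAβ hA hθ hθδ hw hw' ((n : ℝ) ^ 2) a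
  have h2 := abs_bubble_QD_le ρ n hAβ hA hθ hθδ hw hw' a ((n : ℝ) ^ 2)
  have h3 := abs_bubble_QQ_le ρ n hAβ hA hθ hθδ hw hw' a a
  set E : ℝ := Real.exp (-θ * l1 ((n : ℤ) • (0 : Site 4) - (n : ℤ) • z)) with hE
  set X₂ : ℝ := 8 * n * C * Real.exp (8 * n * δ) with hX₂
  set X₁ : ℝ := 8 * n * ((n : ℝ) ^ 4)⁻¹ * C * Real.exp (8 * n * δ) with hX₁
  set XD : ℝ := 8 * C * Real.exp δ with hXD
  set Z : ℝ := Zl 4 (δ - θ) with hZ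
  have hhalf : (0 : ℝ) < 1 / 2 := by norm_num
  have eabs : ∀ t : ℝ, |1 / 2 * t| = 1 / 2 * |t| := fun t => by rw [abs_mul, abs_of_pos hhalf]
  calc _ ≤ |1 / 2 * tadpole (Ggh n a) (fun x z' a' b => -((-1) * a * (n : ℝ) ^ 4) * (qV ρ n (W c 0) x z' a' b * qV ρ n (W e z) x z' a' b))|
        + |1 / 2 * (bubble (Ggh n a) (((n : ℝ) ^ 2) • gW (W c 0)) (a • qV ρ n (W e z))
            + bubble (Ggh n a) (a • qV ρ n (W c 0)) (((n : ℝ) ^ 2) • gW (W e z))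
            + bubble (Ggh n a) (a • qV ρ n (W c 0)) (a • qV ρ n (W e z)))| := abs_sub _ _
    _ ≤ 1 / 2 * (β * (|(-((-1) * a * (n : ℝ) ^ 4))| * X₁ * X₂ * Z * E))
        + 1 / 2 * (β * (|(n : ℝ) ^ 2| * XD * (|a| * X₂) * g * Z * E) + β * (|a| * X₂ * (|(n : ℝ) ^ 2| * XD) * g * Z * E)
            + β * (|a| * X₂ * (|a| * X₂) * g * Z * E)) := by
        rw [eabs, eabs]
        refine add_le_add (mul_le_mul_of_nonneg_left hT hhalf.le) (mul_le_mul_of_nonneg_left ?_ hhalf.le)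
        refine (abs_add_le _ _).trans (add_le_add ((abs_add_le _ _).trans (add_le_add h1 h2)) h3)
    _ = _ := by ring

end OneScale

/-! ## §3 The road's letters on the scales: one constant, one rate -/

section Scales

/-- [folklore] The road's table scale: `8·q·(κ∕4∕(4q)) = κ∕2` (`q ≠ 0`). -/
theorem eight_mul_rate {q κ : ℝ} (hq : q ≠ 0) : 8 * q * (κ / 4 / (4 * q)) = κ / 2 := by
  field_simp
  ring

/-- [folklore] **THE n-FREE MAJORANTS** (pure algebra at `q ≥ 1`, all letters `≥ 0`): with `β = cβ∕q²`, `C = (q⁴)⁻¹·C₁`, `e^{8qδ} = eH`, `e^{δ} ≤ eD`, `Zl ≤ q⁴·Z₀`,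
the four scaled words are `≤` their `q`-free products:
tadpole `≤ cβ·a·64·C₁²·eH²·Z₀` (true power `q⁻⁴`), cross `≤ cβ·64·a·C₁²·eD·eH·g·Z₀` (`q⁻³`), pure `≤ cβ·64·a²·C₁²·eH²·g·Z₀` (`q⁻⁴`). -/
theorem word_consts_le {q cβ a C₁ eH eD eδ Z Z₀ g : ℝ} (hq : 1 ≤ q) (hcβ : 0 ≤ cβ) (ha : 0 ≤ a) (hC₁ : 0 ≤ C₁) (heH : 0 ≤ eH)
    (heδ : 0 ≤ eδ) (heδD : eδ ≤ eD) (hg : 0 ≤ g) (hZ0 : 0 ≤ Z) (hZ : Z ≤ q ^ 4 * Z₀) :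
    cβ / q ^ 2 * ((|(-((-1) * a * q ^ 4))| * (8 * q * (q ^ 4)⁻¹ * ((q ^ 4)⁻¹ * C₁) * eH) * (8 * q * ((q ^ 4)⁻¹ * C₁) * eH) * Z)
        + (|q ^ 2| * (8 * ((q ^ 4)⁻¹ * C₁) * eδ)) * (|a| * (8 * q * ((q ^ 4)⁻¹ * C₁) * eH)) * g * Z
        + (|a| * (8 * q * ((q ^ 4)⁻¹ * C₁) * eH)) * (|q ^ 2| * (8 * ((q ^ 4)⁻¹ * C₁) * eδ)) * g * Z
        + (|a| * (8 * q * ((q ^ 4)⁻¹ * C₁) * eH)) * (|a| * (8 * q * ((q ^ 4)⁻¹ * C₁) * eH)) * g * Z)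
      ≤ cβ * (a * 64 * C₁ ^ 2 * eH ^ 2 * Z₀) + cβ * (64 * a * C₁ ^ 2 * eD * eH * g * Z₀) + cβ * (64 * a * C₁ ^ 2 * eD * eH * g * Z₀)
        + cβ * (64 * a ^ 2 * C₁ ^ 2 * eH ^ 2 * g * Z₀) := by
  have hq0 : 0 < q := by linarith
  have hq3 : 1 ≤ q ^ 3 := one_le_pow₀ hq
  have hq4 : 1 ≤ q ^ 4 := one_le_pow₀ hq
  have hq4pos : (0 : ℝ) < q ^ 4 := by positivity
  have hZ₀ : 0 ≤ Z₀ := le_of_mul_le_mul_left (by rw [mul_zero]; exact hZ0.trans hZ) hq4pos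
  have heD : 0 ≤ eD := heδ.trans heδD
  rw [abs_of_nonneg ha, abs_of_nonneg (by positivity : (0 : ℝ) ≤ q ^ 2),
    show |(-((-1) * a * q ^ 4))| = a * q ^ 4 by rw [show -((-1) * a * q ^ 4) = a * q ^ 4 by ring]; exact abs_of_nonneg (by positivity)]
  -- tadpole: `Z ≤ q⁴Z₀`, then `K·q⁻⁴ ≤ K`
  have hT : cβ / q ^ 2 * (a * q ^ 4 * (8 * q * (q ^ 4)⁻¹ * ((q ^ 4)⁻¹ * C₁) * eH) * (8 * q * ((q ^ 4)⁻¹ * C₁) * eH) * Z)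
      ≤ cβ * (a * 64 * C₁ ^ 2 * eH ^ 2 * Z₀) := by
    set R : ℝ := cβ / q ^ 2 * (a * q ^ 4 * (8 * q * (q ^ 4)⁻¹ * ((q ^ 4)⁻¹ * C₁) * eH) * (8 * q * ((q ^ 4)⁻¹ * C₁) * eH)) with hR
    have hR0 : 0 ≤ R := by positivity
    have e : (q ^ 4 * Z₀) * R = cβ * (a * 64 * C₁ ^ 2 * eH ^ 2 * Z₀) * (q ^ 4)⁻¹ := by
      rw [hR]; field_simp; ring
    calc _ = Z * R := by rw [hR]; ring
      _ ≤ (q ^ 4 * Z₀) * R := mul_le_mul_of_nonneg_right hZ hR0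
      _ = cβ * (a * 64 * C₁ ^ 2 * eH ^ 2 * Z₀) * (q ^ 4)⁻¹ := e
      _ ≤ cβ * (a * 64 * C₁ ^ 2 * eH ^ 2 * Z₀) := mul_le_of_le_one_right (by positivity) (inv_le_one_of_one_le₀ hq4)
  -- cross: `eδ ≤ eD`, `Z ≤ q⁴Z₀`, then `K·q⁻³ ≤ K`
  have hB1 : cβ / q ^ 2 * ((q ^ 2 * (8 * ((q ^ 4)⁻¹ * C₁) * eδ)) * (a * (8 * q * ((q ^ 4)⁻¹ * C₁) * eH)) * g * Z)
      ≤ cβ * (64 * a * C₁ ^ 2 * eD * eH * g * Z₀) := by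
    set R : ℝ := cβ / q ^ 2 * (q ^ 2 * (8 * ((q ^ 4)⁻¹ * C₁))) * (a * (8 * q * ((q ^ 4)⁻¹ * C₁) * eH)) * g with hR
    have hR0 : 0 ≤ R := by positivity
    have e : (eD * (q ^ 4 * Z₀)) * R = cβ * (64 * a * C₁ ^ 2 * eD * eH * g * Z₀) * (q ^ 3)⁻¹ := by
      rw [hR]; field_simp; ring
    calc _ = (eδ * Z) * R := by rw [hR]; ring
      _ ≤ (eD * (q ^ 4 * Z₀)) * R := mul_le_mul_of_nonneg_right (mul_le_mul heδD hZ hZ0 heD) hR0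
      _ = cβ * (64 * a * C₁ ^ 2 * eD * eH * g * Z₀) * (q ^ 3)⁻¹ := e
      _ ≤ cβ * (64 * a * C₁ ^ 2 * eD * eH * g * Z₀) := mul_le_of_le_one_right (by positivity) (inv_le_one_of_one_le₀ hq3)
  have hB2 : cβ / q ^ 2 * ((a * (8 * q * ((q ^ 4)⁻¹ * C₁) * eH)) * (q ^ 2 * (8 * ((q ^ 4)⁻¹ * C₁) * eδ)) * g * Z)
      ≤ cβ * (64 * a * C₁ ^ 2 * eD * eH * g * Z₀) := by
    have e : (a * (8 * q * ((q ^ 4)⁻¹ * C₁) * eH)) * (q ^ 2 * (8 * ((q ^ 4)⁻¹ * C₁) * eδ))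
        = (q ^ 2 * (8 * ((q ^ 4)⁻¹ * C₁) * eδ)) * (a * (8 * q * ((q ^ 4)⁻¹ * C₁) * eH)) := mul_comm _ _
    rw [e]; exact hB1
  -- pure: `Z ≤ q⁴Z₀`, then `K·q⁻⁴ ≤ K`
  have hB3 : cβ / q ^ 2 * ((a * (8 * q * ((q ^ 4)⁻¹ * C₁) * eH)) * (a * (8 * q * ((q ^ 4)⁻¹ * C₁) * eH)) * g * Z)
      ≤ cβ * (64 * a ^ 2 * C₁ ^ 2 * eH ^ 2 * g * Z₀) := by
    set R : ℝ := cβ / q ^ 2 * ((a * (8 * q * ((q ^ 4)⁻¹ * C₁) * eH)) * (a * (8 * q * ((q ^ 4)⁻¹ * C₁) * eH)) * g) with hR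
    have hR0 : 0 ≤ R := by positivity
    have e : (q ^ 4 * Z₀) * R = cβ * (64 * a ^ 2 * C₁ ^ 2 * eH ^ 2 * g * Z₀) * (q ^ 4)⁻¹ := by
      rw [hR]; field_simp; ring
    calc _ = Z * R := by rw [hR]; ring
      _ ≤ (q ^ 4 * Z₀) * R := mul_le_mul_of_nonneg_right hZ hR0
      _ = cβ * (64 * a ^ 2 * C₁ ^ 2 * eH ^ 2 * g * Z₀) * (q ^ 4)⁻¹ := e
      _ ≤ cβ * (64 * a ^ 2 * C₁ ^ 2 * eH ^ 2 * g * Z₀) := mul_le_of_le_one_right (by positivity) (inv_le_one_of_one_le₀ hq4)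
  rw [mul_add, mul_add, mul_add]
  linarith

variable {a : ℝ}

/-- [folklore] **«(C3) DECAY, m-UNIFORM ON THE SCALES»**: for `L ≥ 2`, `a > 0` there are `KB ≥ 0` and `σB > 0` (functions of `L, a` only) such that for every
`k ≥ 1`, `n = L^k`, every in-block root `r ∈ box 4 n` and all `c e z`:
`|BR n c e z| ≤ KB·e^{−σB|z|₁}` — the bracket of the four `Q′`-words at the road's dressed weights `colH G₀ n`, stencil root `ctrHalf n`, unit ray. -/
theorem exists_abs_BR_road_le {L : ℕ} (hL : 2 ≤ L) (ha : 0 < a) :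
    ∃ KB σB : ℝ, 0 < σB ∧ 0 ≤ KB ∧ ∀ (k : ℕ), 1 ≤ k → ∀ (n : ℕ) [NeZero n], n = L ^ k → ∀ (r : Fin (3 + 1) → ℕ), r ∈ box (3 + 1) n →
      ∀ (c e : Fin 4) (z : Site 4),
        |(1 / 2) * tadpole (Ggh n a) (∑ κ : Fin 4, ∑ l : Fin 4,
              wsum (colH (coDressKBmAt (toSite r) n (KInvStep (d := 3) n 0)) n c 0 κ)
                (fun u => wsum (colH (coDressKBmAt (toSite r) n (KInvStep (d := 3) n 0)) n e z l)
                  (fun v' => (-((-1) * a * (n : ℝ) ^ 4)) • qSqAt (ctrHalf n) n κ u l v')))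
          - (1 / 2) * (bubble (Ggh n a)
                (∑ κ : Fin 4, wsum (colH (coDressKBmAt (toSite r) n (KInvStep (d := 3) n 0)) n c 0 κ) (fun u => ((n : ℝ) ^ 2) • ghCur κ u))
                (∑ κ : Fin 4, wsum (colH (coDressKBmAt (toSite r) n (KInvStep (d := 3) n 0)) n e z κ) (fun u => a • qAntiAt (ctrHalf n) n κ u))
              + bubble (Ggh n a)
                (∑ κ : Fin 4, wsum (colH (coDressKBmAt (toSite r) n (KInvStep (d := 3) n 0)) n c 0 κ) (fun u => a • qAntiAt (ctrHalf n) n κ u))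
                (∑ κ : Fin 4, wsum (colH (coDressKBmAt (toSite r) n (KInvStep (d := 3) n 0)) n e z κ) (fun u => ((n : ℝ) ^ 2) • ghCur κ u))
              + bubble (Ggh n a)
                (∑ κ : Fin 4, wsum (colH (coDressKBmAt (toSite r) n (KInvStep (d := 3) n 0)) n c 0 κ) (fun u => a • qAntiAt (ctrHalf n) n κ u))
                (∑ κ : Fin 4, wsum (colH (coDressKBmAt (toSite r) n (KInvStep (d := 3) n 0)) n e z κ) (fun u => a • qAntiAt (ctrHalf n) n κ u)))|
          ≤ KB * Real.exp (-σB * l1 z) := by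
  obtain ⟨θ₀, g, π, hθ₀, hg, -, hM⟩ := exists_leg_masses (a := a) hL ha
  have hκ := kappa163_pos 4
  set θ₁ : ℝ := min θ₀ (kappa163 4 / 32) with hθ₁def
  have hθ₁ : 0 < θ₁ := lt_min hθ₀ (by positivity)
  -- the n-free letters
  set cβ : ℝ := cG0 4 + cSplit 4 a with hcβ
  set C₁ : ℝ := (MG163 4 * periodConst (kappa163 4) 3) * (1 + 8 * (1 + Real.exp (kappa163 4 / 4))) * Real.exp (kappa163 4 / 4) with hC₁
  set eH : ℝ := Real.exp (kappa163 4 / 2) with heH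
  set eD : ℝ := Real.exp (kappa163 4 / 16) with heD
  set Z₀ : ℝ := (1 + 64 / kappa163 4) ^ 4 with hZ₀
  have hcβ0 : 0 ≤ cβ := add_nonneg (cG0_nonneg 4) (cSplit_nonneg 4 ha)
  have hC₁0 : 0 ≤ C₁ := by
    have := colH_G₀_road_weight_nonneg 0
    simp only [zero_add, Nat.cast_one, one_pow, inv_one, one_mul] at this
    exact this
  refine ⟨(1 / 2) * (cβ * (a * 64 * C₁ ^ 2 * eH ^ 2 * Z₀) + cβ * (64 * a * C₁ ^ 2 * eD * eH * g * Z₀)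
      + cβ * (64 * a * C₁ ^ 2 * eD * eH * g * Z₀) + cβ * (64 * a ^ 2 * C₁ ^ 2 * eH ^ 2 * g * Z₀)), θ₁, hθ₁, by positivity,
    fun k hk n _ hn r hr c e z => ?_⟩
  -- the scale `q = n ≥ 1` as a successor
  obtain ⟨m, rfl⟩ : ∃ m, n = m + 1 := ⟨n - 1, (Nat.succ_pred_eq_of_ne_zero (NeZero.ne n)).symm⟩
  have hq : (1 : ℝ) ≤ ((m + 1 : ℕ) : ℝ) := by exact_mod_cast Nat.succ_pos m
  have hq0 : (0 : ℝ) < ((m + 1 : ℕ) : ℝ) := by linarith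
  -- the two rates
  have hθ0 : 0 ≤ θ₁ / ((m + 1 : ℕ) : ℝ) := by positivity
  have hθle : θ₁ / ((m + 1 : ℕ) : ℝ) ≤ θ₀ / ((m + 1 : ℕ) : ℝ) := div_le_div_of_nonneg_right (min_le_left _ _) hq0.le
  have eδ : kappa163 4 / 4 / (4 * ((m + 1 : ℕ) : ℝ)) = (kappa163 4 / 16) / ((m + 1 : ℕ) : ℝ) := by
    field_simp; ring
  have hθδ : θ₁ / ((m + 1 : ℕ) : ℝ) < kappa163 4 / 4 / (4 * ((m + 1 : ℕ) : ℝ)) := by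
    rw [eδ]
    exact div_lt_div_of_pos_right (lt_of_le_of_lt (min_le_right _ _) (by linarith)) hq0
  -- the letters at this scale
  have hW := fun μ y κ u => abs_colH_G₀_road_le m hr μ y κ u
  obtain ⟨hA, -⟩ := hM k hk (m + 1) hn _ hθ0 hθle
  have hAβ : ∀ x y : Site 4, |Ggh (m + 1) a x y () ()| ≤ cβ / (((m + 1 : ℕ) : ℝ)) ^ 2 := fun x y => bdd_Ggh_sharp m ha x y () ()
  have h := abs_BR_le (ctrHalf (m + 1)) (m + 1) hW hθ0 hθδ hAβ hA c e z
  -- the separation factor in block units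
  have eS : Real.exp (-(θ₁ / ((m + 1 : ℕ) : ℝ)) * l1 (((m + 1 : ℕ) : ℤ) • (0 : Site 4) - ((m + 1 : ℕ) : ℤ) • z))
      = Real.exp (-θ₁ * l1 z) := by
    rw [← smul_sub, l1_natSmul, zero_sub]
    congr 1
    rw [show l1 (-z) = l1 z by rw [← zero_sub, l1_sub_symm, sub_zero]]
    field_simp
  rw [eS] at h
  -- the n-free majorant of the four words
  have heHeq : Real.exp (8 * ((m + 1 : ℕ) : ℝ) * (kappa163 4 / 4 / (4 * ((m + 1 : ℕ) : ℝ)))) = eH := by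
    rw [heH, eight_mul_rate hq0.ne']
  have heδD : Real.exp (kappa163 4 / 4 / (4 * ((m + 1 : ℕ) : ℝ))) ≤ eD := by
    rw [heD, eδ, Real.exp_le_exp]
    exact div_le_self (by positivity) hq
  have hZ : Zl 4 (kappa163 4 / 4 / (4 * ((m + 1 : ℕ) : ℝ)) - θ₁ / ((m + 1 : ℕ) : ℝ)) ≤ ((m + 1 : ℕ) : ℝ) ^ 4 * Z₀ := by
    refine Zl_road_le hq hκ ?_
    rw [eδ, ← sub_div]
    refine div_le_div_of_nonneg_right ?_ hq0.le
    have := min_le_right θ₀ (kappa163 4 / 32)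
    linarith
  have hZ0 : 0 ≤ Zl 4 (kappa163 4 / 4 / (4 * ((m + 1 : ℕ) : ℝ)) - θ₁ / ((m + 1 : ℕ) : ℝ)) := (Zl_pos (by linarith)).le
  rw [heHeq] at h
  have key := word_consts_le (cβ := cβ) (a := a) (C₁ := C₁) (eH := eH) (g := g) hq hcβ0 ha.le hC₁0 (Real.exp_pos _).le
    (Real.exp_pos _).le heδD hg hZ0 hZ
  refine h.trans ?_
  refine mul_le_mul_of_nonneg_right (mul_le_mul_of_nonneg_left key (by norm_num)) (Real.exp_pos _).le

end Scales

/-! ## §4 The (1.22) rows of PART 16: `hMRB` and `hCB` -/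

section Rows

variable {a : ℝ}

/-- [folklore] **«(C3) ON THE SCALES» — THE OWNER's PART 16 BINDERS `hMRB ∕ hCB` AS THEOREMS.**  For `L ≥ 2`, `a > 0` and a per-scale root family
`r (m+1) ∈ box 4 (m+1)`, there is ONE constant `CB` such that for every `m ≥ 1` the bracket `BR (L^m)` of the four `Q′`-words (at the road's dressed weights
`colH G₀ (L^m)`, `G₀ = coDressKBmAt (toSite (r (L^m))) (L^m) (KInvStep 3 (L^m) 0)`, stencil root `ctrHalf (L^m)`, unit ray) has ABSOLUTELY SUMMABLE second moments in
every channel `(c, e)` and `|secondMoment (BR (L^m)) μ ν| ≤ CB` for all `μ ν` — `RoadEndBFxRoadScalesJ3S`'s `hMRB` ∕ `hCB` character for character (`Lc ↦ L`,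
`CB` uniform in `m`).  By §3 (`|BR| ≤ KB·e^{−σB|z|₁}`) and the Literature's `secondMoment_abs_le_of_decay510` ∕ `absMoment₂_of_decay510`. -/
theorem exists_C3_rows {L : ℕ} [NeZero L] (hL : 2 ≤ L) (ha : 0 < a) {r : ℕ → Fin (3 + 1) → ℕ}
    (hr : ∀ m : ℕ, r (m + 1) ∈ box (3 + 1) (m + 1)) :
    ∃ CB : ℝ, ∀ (m : ℕ), 1 ≤ m →
      (∀ c e : Fin 4, AbsMoment₂ (fun z : Site 4 =>
        ((1 / 2) * tadpole (Ggh (L ^ m) a) (∑ κ : Fin 4, ∑ l : Fin 4,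
              wsum (colH (coDressKBmAt (toSite (r (L ^ m))) (L ^ m) (KInvStep (d := 3) (L ^ m) 0)) (L ^ m) c 0 κ)
                (fun u => wsum (colH (coDressKBmAt (toSite (r (L ^ m))) (L ^ m) (KInvStep (d := 3) (L ^ m) 0)) (L ^ m) e z l)
                  (fun v' => (-((-1) * a * (((L ^ m) : ℕ) : ℝ) ^ 4)) • qSqAt (ctrHalf (L ^ m)) (L ^ m) κ u l v')))
          - (1 / 2) * (bubble (Ggh (L ^ m) a)
                (∑ κ : Fin 4, wsum (colH (coDressKBmAt (toSite (r (L ^ m))) (L ^ m) (KInvStep (d := 3) (L ^ m) 0)) (L ^ m) c 0 κ)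
                  (fun u => ((((L ^ m) : ℕ) : ℝ) ^ 2) • ghCur κ u))
                (∑ κ : Fin 4, wsum (colH (coDressKBmAt (toSite (r (L ^ m))) (L ^ m) (KInvStep (d := 3) (L ^ m) 0)) (L ^ m) e z κ)
                  (fun u => a • qAntiAt (ctrHalf (L ^ m)) (L ^ m) κ u))
              + bubble (Ggh (L ^ m) a)
                (∑ κ : Fin 4, wsum (colH (coDressKBmAt (toSite (r (L ^ m))) (L ^ m) (KInvStep (d := 3) (L ^ m) 0)) (L ^ m) c 0 κ)
                  (fun u => a • qAntiAt (ctrHalf (L ^ m)) (L ^ m) κ u))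
                (∑ κ : Fin 4, wsum (colH (coDressKBmAt (toSite (r (L ^ m))) (L ^ m) (KInvStep (d := 3) (L ^ m) 0)) (L ^ m) e z κ)
                  (fun u => ((((L ^ m) : ℕ) : ℝ) ^ 2) • ghCur κ u))
              + bubble (Ggh (L ^ m) a)
                (∑ κ : Fin 4, wsum (colH (coDressKBmAt (toSite (r (L ^ m))) (L ^ m) (KInvStep (d := 3) (L ^ m) 0)) (L ^ m) c 0 κ)
                  (fun u => a • qAntiAt (ctrHalf (L ^ m)) (L ^ m) κ u))
                (∑ κ : Fin 4, wsum (colH (coDressKBmAt (toSite (r (L ^ m))) (L ^ m) (KInvStep (d := 3) (L ^ m) 0)) (L ^ m) e z κ)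
                  (fun u => a • qAntiAt (ctrHalf (L ^ m)) (L ^ m) κ u)))))) ∧
      ∀ μ ν : Fin 4, |B12Beta.secondMoment (fun (c e : Fin 4) (z : Site 4) =>
        ((1 / 2) * tadpole (Ggh (L ^ m) a) (∑ κ : Fin 4, ∑ l : Fin 4,
              wsum (colH (coDressKBmAt (toSite (r (L ^ m))) (L ^ m) (KInvStep (d := 3) (L ^ m) 0)) (L ^ m) c 0 κ)
                (fun u => wsum (colH (coDressKBmAt (toSite (r (L ^ m))) (L ^ m) (KInvStep (d := 3) (L ^ m) 0)) (L ^ m) e z l)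
                  (fun v' => (-((-1) * a * (((L ^ m) : ℕ) : ℝ) ^ 4)) • qSqAt (ctrHalf (L ^ m)) (L ^ m) κ u l v')))
          - (1 / 2) * (bubble (Ggh (L ^ m) a)
                (∑ κ : Fin 4, wsum (colH (coDressKBmAt (toSite (r (L ^ m))) (L ^ m) (KInvStep (d := 3) (L ^ m) 0)) (L ^ m) c 0 κ)
                  (fun u => ((((L ^ m) : ℕ) : ℝ) ^ 2) • ghCur κ u))
                (∑ κ : Fin 4, wsum (colH (coDressKBmAt (toSite (r (L ^ m))) (L ^ m) (KInvStep (d := 3) (L ^ m) 0)) (L ^ m) e z κ)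
                  (fun u => a • qAntiAt (ctrHalf (L ^ m)) (L ^ m) κ u))
              + bubble (Ggh (L ^ m) a)
                (∑ κ : Fin 4, wsum (colH (coDressKBmAt (toSite (r (L ^ m))) (L ^ m) (KInvStep (d := 3) (L ^ m) 0)) (L ^ m) c 0 κ)
                  (fun u => a • qAntiAt (ctrHalf (L ^ m)) (L ^ m) κ u))
                (∑ κ : Fin 4, wsum (colH (coDressKBmAt (toSite (r (L ^ m))) (L ^ m) (KInvStep (d := 3) (L ^ m) 0)) (L ^ m) e z κ)
                  (fun u => ((((L ^ m) : ℕ) : ℝ) ^ 2) • ghCur κ u))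
              + bubble (Ggh (L ^ m) a)
                (∑ κ : Fin 4, wsum (colH (coDressKBmAt (toSite (r (L ^ m))) (L ^ m) (KInvStep (d := 3) (L ^ m) 0)) (L ^ m) c 0 κ)
                  (fun u => a • qAntiAt (ctrHalf (L ^ m)) (L ^ m) κ u))
                (∑ κ : Fin 4, wsum (colH (coDressKBmAt (toSite (r (L ^ m))) (L ^ m) (KInvStep (d := 3) (L ^ m) 0)) (L ^ m) e z κ)
                  (fun u => a • qAntiAt (ctrHalf (L ^ m)) (L ^ m) κ u))))) μ ν| ≤ CB := by
  obtain ⟨KB, σB, hσB, hKB, H⟩ := exists_abs_BR_road_le (a := a) hL ha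
  refine ⟨KB * ∑' x : Site 4, l1 x ^ 2 * Real.exp (-σB * l1 x), fun m hm => ?_⟩
  have hrm : r (L ^ m) ∈ box (3 + 1) (L ^ m) := box_of_succ hr (L ^ m)
  have hD : ∀ c e : Fin 4, Decay510 (fun z : Site 4 =>
      ((1 / 2) * tadpole (Ggh (L ^ m) a) (∑ κ : Fin 4, ∑ l : Fin 4,
            wsum (colH (coDressKBmAt (toSite (r (L ^ m))) (L ^ m) (KInvStep (d := 3) (L ^ m) 0)) (L ^ m) c 0 κ)
              (fun u => wsum (colH (coDressKBmAt (toSite (r (L ^ m))) (L ^ m) (KInvStep (d := 3) (L ^ m) 0)) (L ^ m) e z l)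
                (fun v' => (-((-1) * a * (((L ^ m) : ℕ) : ℝ) ^ 4)) • qSqAt (ctrHalf (L ^ m)) (L ^ m) κ u l v')))
        - (1 / 2) * (bubble (Ggh (L ^ m) a)
              (∑ κ : Fin 4, wsum (colH (coDressKBmAt (toSite (r (L ^ m))) (L ^ m) (KInvStep (d := 3) (L ^ m) 0)) (L ^ m) c 0 κ)
                (fun u => ((((L ^ m) : ℕ) : ℝ) ^ 2) • ghCur κ u))
              (∑ κ : Fin 4, wsum (colH (coDressKBmAt (toSite (r (L ^ m))) (L ^ m) (KInvStep (d := 3) (L ^ m) 0)) (L ^ m) e z κ)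
                (fun u => a • qAntiAt (ctrHalf (L ^ m)) (L ^ m) κ u))
            + bubble (Ggh (L ^ m) a)
              (∑ κ : Fin 4, wsum (colH (coDressKBmAt (toSite (r (L ^ m))) (L ^ m) (KInvStep (d := 3) (L ^ m) 0)) (L ^ m) c 0 κ)
                (fun u => a • qAntiAt (ctrHalf (L ^ m)) (L ^ m) κ u))
              (∑ κ : Fin 4, wsum (colH (coDressKBmAt (toSite (r (L ^ m))) (L ^ m) (KInvStep (d := 3) (L ^ m) 0)) (L ^ m) e z κ)
                (fun u => ((((L ^ m) : ℕ) : ℝ) ^ 2) • ghCur κ u))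
            + bubble (Ggh (L ^ m) a)
              (∑ κ : Fin 4, wsum (colH (coDressKBmAt (toSite (r (L ^ m))) (L ^ m) (KInvStep (d := 3) (L ^ m) 0)) (L ^ m) c 0 κ)
                (fun u => a • qAntiAt (ctrHalf (L ^ m)) (L ^ m) κ u))
              (∑ κ : Fin 4, wsum (colH (coDressKBmAt (toSite (r (L ^ m))) (L ^ m) (KInvStep (d := 3) (L ^ m) 0)) (L ^ m) e z κ)
                (fun u => a • qAntiAt (ctrHalf (L ^ m)) (L ^ m) κ u))))) KB σB :=
    fun c e z => H m hm (L ^ m) rfl (r (L ^ m)) hrm c e z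
  exact ⟨fun c e => absMoment₂_of_decay510 hσB (hD c e), fun μ ν => abs_secondMoment_le hσB (hD μ ν)⟩

end Rows

end Summit.QuantumFields.BalabanUV.Beta.D1BFx.GhostQWordsScales

end
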